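import Summits.QuantumFields.YangMills.Theorems.BalabanUVNodesN06Delta2AtPinsC2Phys
import Literature.MathematicalPhysics.QuantumFieldTheory.Balaban1983to89.B9BackgroundsKLevelV1R

/-!
# BalabanUVNodes ∕ N06 ([B9], `Dag.B9_main`) — (3.137) SUP ∕ BLOCK-L² FOR def-Y's GENUINE RESIDUAL `Δ⁽²⁾ = delta2OfY (𝔠 x).form` AT THE PINS, AT def-Y's
# CLASS-PARAMETRIC CARRIER `bg9YR 𝔸 G R₁ R₂` (CASCADE-R ∕ STEP-3 faces of `…N06Delta2AtPinsC2Phys` v1.1's free-weight theorems)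

Track A of `YM-PLAN.md` (cell `pub-ymgap`, HUMAN RULING D-0062), node **N06** = [Balaban1985BackgroundPropagators] Thms 3.1–3.15; seat `pub-ymgap-dag-n06-w8` (g3), 2026-08-28.
WHY.  The `(H\*J)` road of this lineage (F5–F11: `hD2sup ⟸ hC2 + hreg + hGDsup + hCsup`, `Thm/…N06HTransposeAtPinsPhys`) is typed with every regime binder at MODULE 3's
small-cube class `(bg9Y …).Reg335 c35Y α₀ U`.  node00-def-Y g22 RULING-W′ + dag-n06-d g12 ANSWER-DEFY-STEP3 (pub-ymgap INBOX 2026-08-28 11:58Z ∕ 12:09Z): the class of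
record becomes PRINT's class, re-press form (α) — objects stay over `bg9Y`, ONLY the premises read `(bg9YP 𝔸 G x).Reg335 c35Y α₀ U`.  THIS FILE re-types the two free-weight
theorems of `…N06Delta2AtPinsC2Phys` (v1.1) ONCE at def-Y's class-parametric carrier (`B9BackgroundsKLevelV1R`): premises `(bg9YR (M_N(ℂ)) SU(N) R₁ R₂ x).Reg335 c α₀ U`
(`= R₁ x c α₀ U`), constant `c` FREE, objects UNCHANGED (`𝔬12`, `D2coK … (bg9Y … x) …`, `U : (bg9Y …).Cfg`); the one class fact the proofs read («`U` is `SU(N)`-valued»,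
`hU.1.1`) enters as the class axiom `hG : MemOfFam SU(N) R₁`.  `bg9Y` (`c := c35Y`) and print's `bg9YP` specialise by `rfl` (`bg9Y_eq_bg9YR`, `bg9YP_eq_bg9YR`).
★★ `hD2sup_of_form_schemas_wR`, ★★ `hD2L2_of_form_schemas_wR` — proofs VERBATIM those of the originals.
HONEST FRAMING.  Kernel bookkeeping ((3.136) trace algebra, [4] (2.51)∕(2.54)∕(2.60)∕(2.61), Schur); COUNT-NEUTRAL; nothing of [B9]∕[5] asserted — [5]'s (149) size of `C⁽²⁾`
(`hC2`) and the `(H\*J)` line (`hHJ`) stay DISPLAYED letters about the genuine objects; N06 NOT discharged; K1 NOT closed.  One finite 𝕋⁴ programme at fixed `ε` — NOT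
continuum, NOT OS, NOT the mass gap ∕ Clay.  0 `def`, 0 `sorry`.
-/

noncomputable section

namespace Summit.QuantumFields.YangMills.BalabanUVNodes.N06Delta2AtPinsC2PhysR

open Literature.MathematicalPhysics.QuantumFieldTheory.Balaban1983to89
open Literature.MathematicalPhysics.QuantumFieldTheory.Balaban1983to89.Node00 (CfgY FBondY IBondY GpY parSymY parBY trDualMatY trAdjY JY Stage3Params C2Y
  resYOfC2 resYOfC2_Δ2 resYOfC2_Δ2_isSymmTr)
open Literature.MathematicalPhysics.QuantumFieldTheory.Balaban1983to89.B9Eq3132SectDLetters (HDY)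
open Literature.MathematicalPhysics.QuantumFieldTheory.Balaban1983to89.B9Thm34Ext (toB6)
open Literature.MathematicalPhysics.QuantumFieldTheory.Balaban1983to89.B11SectG (RowSum)
open Literature.MathematicalPhysics.QuantumFieldTheory.Balaban1983to89.B6RandomWalk (HasMajorant hasMajorant_mono)
open Literature.MathematicalPhysics.QuantumFieldTheory.Balaban1983to89.B9SectDL2Decay (BlockBd)
open Literature.MathematicalPhysics.QuantumFieldTheory.Balaban1983to89.B9Thm312Whole (GeoOK)
open Literature.MathematicalPhysics.QuantumFieldTheory.Balaban1983to89.B9RWSums343to347Whole (Facts347)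
open Literature.MathematicalPhysics.QuantumFieldTheory.Balaban1983to89.B9RWSumsDefinitePins (PinPrims)
open Literature.MathematicalPhysics.QuantumFieldTheory.Balaban1983to89.B9RWSums347DefiniteFaces (exp261 lemma21Pack_geo9Y)
open Literature.MathematicalPhysics.QuantumFieldTheory.Balaban1983to89.B9RowSum261DefiniteFaces (rowConst261 rowConst261_nonneg rowConst261_spec_of_rowSum261)
open Literature.MathematicalPhysics.QuantumFieldTheory.Balaban1983to89.B9RWSums346Schur (scaleTransfer_len_rpow)
open Literature.MathematicalPhysics.QuantumFieldTheory.Balaban1983to89.B9PinMembersKLevelV1 (MemberY geo9Y bg9Y)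
open Literature.MathematicalPhysics.QuantumFieldTheory.Balaban1983to89.B9BackgroundsKLevelV1R (RegFamY bg9YR MemOfFam)
open Literature.MathematicalPhysics.QuantumFieldTheory.Balaban1983to89.B9GeoLemma21KLevelV1 (geo9Y_len_pos geo9Y_dist_triangle geo9Y_dist_comm rowSum261_geo9Y)
open Literature.MathematicalPhysics.QuantumFieldTheory.Balaban1983to89.B9GeoNormsKLevelV1 (geo9K_dist_nonneg)
open Literature.MathematicalPhysics.QuantumFieldTheory.Balaban1983to89.B7Prop2SpecialUnitary (specialUnitaryUnits specialUnitaryUnits_le_unitaryUnits)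
open Literature.MathematicalPhysics.QuantumFieldTheory.Balaban1983to89.B9CoReadingCoords (XBK blkBK)
open Literature.MathematicalPhysics.QuantumFieldTheory.Balaban1983to89.B9CoReadingCoordsH (XHK)
open Literature.MathematicalPhysics.QuantumFieldTheory.Balaban1983to89.B9CoReadingCoordsS (XSK)
open Literature.MathematicalPhysics.QuantumFieldTheory.Balaban1983to89.B9CoReadingCoordsTranspose (TrIdx trBasis)
open Literature.MathematicalPhysics.QuantumFieldTheory.Balaban1983to89.B9Thm39ReadingCoords (cR39 basisBound39)
open Literature.MathematicalPhysics.QuantumFieldTheory.Balaban1983to89.Node00.OpsYSectDCoords (cR39_trBasis_pos)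
open Literature.MathematicalPhysics.QuantumFieldTheory.Balaban1983to89.B9PerturbationL2Delta2 (D2coK blockBd_d2coK_of_sup_symm)
open Literature.MathematicalPhysics.QuantumFieldTheory.Balaban1983to89.B9Delta2FormMajorant (C2FormMaj hasMajorant_coordOpK_delta2OfY)
open scoped Matrix.Norms.L2Operator

variable {N : ℕ} [NeZero N] {θ : Stage3Params} {Mstar : ℕ}
variable [∀ x : MemberY θ.d₆ θ.ℓ₆ θ.hd' θ.hL' θ.b₀ θ.b₁ Mstar, Fintype (geo9Y x).Site]

/-- the kernel domination: `r·(…·(t·θ)·…)·W·e ≤ θ₂·θ·W·e` once `r·(…·t·…) ≤ θ₂` and `θ, W, e ≥ 0`. [cite: Balaban1985BackgroundPropagators, (3.137) p.423, bookkeeping] -/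
private theorem kernel_dom {r n b κ t θ C c θ₂ W e : ℝ} (h : r * (n * b * κ * t * C * c) ≤ θ₂) (hθ : 0 ≤ θ) (hW : 0 ≤ W) (he : 0 ≤ e) :
    r * (n * b * κ * (t * θ) * C * c) * W * e ≤ θ₂ * θ * W * e := by
  have h1 : r * (n * b * κ * (t * θ) * C * c) * W * e = (r * (n * b * κ * t * C * c)) * (θ * (W * e)) := by ring
  rw [h1, show θ₂ * θ * W * e = θ₂ * (θ * (W * e)) by ring]
  exact mul_le_mul_of_nonneg_right h (mul_nonneg hθ (mul_nonneg hW he))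

/-- ★★ **`hD2sup` FOR ANY WEIGHT SPLIT**: as `hD2sup_of_form_schemas`, with the form letter at a free weight family `w_C` and the current letter at a free weight family
`w_H`, `0 ≦ w_C, w_H`, `w_C(c)·w_H(c) ≦ ((Lʲη)_c²)⁻¹` — conclusion unchanged (edition 30's `hD2sup` at `𝔯 := resYOfC2 N θ M⋆ 𝔠`).
[cite: Balaban1985BackgroundPropagators, (3.136)–(3.137) pp.422–423, (3.11) p.392, p.398; Balaban1985Averaging, (149) p.40; Balaban1984PropagatorsII, (2.51) p.232, (2.54), (2.60)–(2.61) pp.233–234] -/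
theorem hD2sup_of_form_schemas_wR (q : PinPrims) (hq : q.OK) (H : MemberY θ.d₆ θ.ℓ₆ θ.hd' θ.hL' θ.b₀ θ.b₁ Mstar → Prop) (𝔠 : C2Y N θ Mstar)
    (R₁ R₂ : RegFamY θ.d₆ θ.ℓ₆ θ.hd' θ.hL' θ.b₀ θ.b₁ Mstar (Matrix (Fin N) (Fin N) ℂ)) (c : ℝ)
    (𝔬12 : ∀ x : MemberY θ.d₆ θ.ℓ₆ θ.hd' θ.hL' θ.b₀ θ.b₁ Mstar, B9Thm312Whole.Ops (geo9Y x) (bg9Y (Matrix (Fin N) (Fin N) ℂ) (specialUnitaryUnits (Fin N)) x)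
      (XBK (TrIdx N) x.toKIdx) (XBK (TrIdx N) x.toKIdx) (XHK (TrIdx N) x.toKIdx) (XSK (TrIdx N) x.toKIdx))
    (bI : ∀ x : MemberY θ.d₆ θ.ℓ₆ θ.hd' θ.hL' θ.b₀ θ.b₁ Mstar, FBondY x.toKIdx → IBondY x.toKIdx)
    (hblk12 : ∀ x : MemberY θ.d₆ θ.ℓ₆ θ.hd' θ.hL' θ.b₀ θ.b₁ Mstar, (𝔬12 x).blk = blkBK x.toKIdx (bI x))
    (wC wH : ∀ x : MemberY θ.d₆ θ.ℓ₆ θ.hd' θ.hL' θ.b₀ θ.b₁ Mstar, IBondY x.toKIdx → ℝ)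
    (hwC : ∀ x c, 0 ≤ wC x c) (hwH : ∀ x c, 0 ≤ wH x c) (hww : ∀ x c, wC x c * wH x c ≤ ((geo9Y x).len c ^ 2)⁻¹)
    (κC δC tHJ ρR δ₂ θ₂ M a : ℝ) (hκC : 0 ≤ κC) (htHJ : 0 ≤ tHJ) (hρR : 0 < ρR) (hδ₂ : 0 ≤ δ₂) (hM : 0 < M)
    (hδC : δ₂ + q.αF * ((1 - 2 * q.α) * q.δ₀) + ρR ≤ δC)
    (hθ₂ : (cR39 (trBasis N))⁻¹ * (2 * N * basisBound39 (trBasis N) ^ 2 * κC * tHJ * (((θ.ℓ₆ + 1 : ℕ) : ℝ) ^ 2) *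
      rowConst261 (geo9Y (d := θ.d₆) (ℓ := θ.ℓ₆) (hd := θ.hd') (hL := θ.hL') (b₀ := θ.b₀) (b₁ := θ.b₁) (Mstar := Mstar)) ρR) ≤ θ₂)
    (hC2 : ∀ x : MemberY θ.d₆ θ.ℓ₆ θ.hd' θ.hL' θ.b₀ θ.b₁ Mstar, M ≤ (geo9Y x).M → ∀ α₀ : ℝ, 0 < α₀ → (geo9Y x).M * α₀ ≤ a →
      ∀ U : (bg9Y (Matrix (Fin N) (Fin N) ℂ) (specialUnitaryUnits (Fin N)) x).Cfg,
        (bg9YR (Matrix (Fin N) (Fin N) ℂ) (specialUnitaryUnits (Fin N)) R₁ R₂ x).Reg335 c α₀ U →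
        (bg9YR (Matrix (Fin N) (Fin N) ℂ) (specialUnitaryUnits (Fin N)) R₁ R₂ x).Reg336 c α₀ U →
          C2FormMaj x.toKIdx (g := geo9Y x) (bI x) (fun c => c) (𝔠 x).form U κC δC (wC x))
    (hHJ : ∀ x : MemberY θ.d₆ θ.ℓ₆ θ.hd' θ.hL' θ.b₀ θ.b₁ Mstar, M ≤ (geo9Y x).M → ∀ α₀ : ℝ, 0 < α₀ → (geo9Y x).M * α₀ ≤ a →
      ∀ U : (bg9Y (Matrix (Fin N) (Fin N) ℂ) (specialUnitaryUnits (Fin N)) x).Cfg,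
        (bg9YR (Matrix (Fin N) (Fin N) ℂ) (specialUnitaryUnits (Fin N)) R₁ R₂ x).Reg335 c α₀ U →
        (bg9YR (Matrix (Fin N) (Fin N) ℂ) (specialUnitaryUnits (Fin N)) R₁ R₂ x).Reg336 c α₀ U →
          ∀ c : IBondY x.toKIdx,
            ‖trAdjY (trDualMatY N) (HDY x.toKIdx (parSymY x.toKIdx) (parBY x.toKIdx) (GpY x.toKIdx (parSymY x.toKIdx)) U) (JY x.toKIdx U) c‖ ≤
              tHJ * ((geo9Y x).M * α₀) * wH x c) :
    ∃ ML : ℝ, ∀ x : MemberY θ.d₆ θ.ℓ₆ θ.hd' θ.hL' θ.b₀ θ.b₁ Mstar, ML ≤ (geo9Y x).M → M ≤ (geo9Y x).M → ∀ α₀ : ℝ, 0 < α₀ → (geo9Y x).M * α₀ ≤ a →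
      ∀ U : (bg9Y (Matrix (Fin N) (Fin N) ℂ) (specialUnitaryUnits (Fin N)) x).Cfg,
        (bg9YR (Matrix (Fin N) (Fin N) ℂ) (specialUnitaryUnits (Fin N)) R₁ R₂ x).Reg335 c α₀ U →
        (bg9YR (Matrix (Fin N) (Fin N) ℂ) (specialUnitaryUnits (Fin N)) R₁ R₂ x).Reg336 c α₀ U →
          HasMajorant (g := toB6 (geo9Y x) 1 (H x)) (𝔬12 x).blk
            (D2coK x.toKIdx (trBasis N) (bg9Y (Matrix (Fin N) (Fin N) ℂ) (specialUnitaryUnits (Fin N)) x) (fun U => U) ((resYOfC2 N θ Mstar 𝔠 x).Δ2) U)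
            (fun (a b : (geo9Y x).Site) => θ₂ * ((geo9Y x).M * α₀) * ((geo9Y x).len a ^ 2)⁻¹ * Real.exp (-(δ₂ * (geo9Y x).dist a b))) := by
  obtain ⟨Mth, -, hfacts, -⟩ :=
    lemma21Pack_geo9Y (d := θ.d₆) (ℓ := θ.ℓ₆) (hd := θ.hd') (hL := θ.hL') (b₀ := θ.b₀) (b₁ := θ.b₁) (Mstar := Mstar) H hq.α_pos hq.α_lt
      hq.δ₀_pos hq.αF_pos (by linarith only [hq.αF_lt])
  obtain ⟨MLσ, hrowc⟩ := rowConst261_spec_of_rowSum261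
    (rowSum261_geo9Y (d := θ.d₆) (ℓ := θ.ℓ₆) (hd := θ.hd') (hL := θ.hL') (b₀ := θ.b₀) (b₁ := θ.b₁) (Mstar := Mstar)) hρR
  have hN : 0 < N := Nat.pos_of_ne_zero (NeZero.ne N)
  have hc0 : 0 < cR39 (trBasis N) := cR39_trBasis_pos hN
  have hτ : 0 ≤ q.αF * ((1 - 2 * q.α) * q.δ₀) :=
    mul_nonneg hq.αF_pos.le (mul_nonneg (by linarith only [hq.α_lt]) hq.δ₀_pos.le)
  refine ⟨max Mth MLσ, fun x hMx hMM α₀ hα ha U hU hU' => ?_⟩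
  have hgeo : GeoOK (geo9Y x) := ⟨geo9Y_dist_triangle x, geo9Y_dist_comm x, geo9K_dist_nonneg x.toKIdx, geo9Y_len_pos x⟩
  have hF := hfacts x ((le_max_left _ _).trans hMx)
  have hθ : 0 ≤ (geo9Y x).M * α₀ := mul_nonneg (hM.le.trans hMM) hα.le
  -- p. 398 transfer for the net weight (Lʲη)⁻² ≥ w_C·w_H
  have hL1 : 1 ≤ (geo9Y x).L := hF.one_le_L
  have hLle : (geo9Y x).L ^ |(-2 : ℝ)| ≤ ((θ.ℓ₆ + 1 : ℕ) : ℝ) ^ 2 := by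
    rw [show |(-2 : ℝ)| = (2 : ℕ) by norm_num, Real.rpow_natCast]
    exact pow_le_pow_left₀ (zero_le_one.trans hL1) hF.L_le 2
  have hT : ∀ (y : (geo9Y x).Site) (c : IBondY x.toKIdx),
      Real.exp (-(q.αF * ((1 - 2 * q.α) * q.δ₀) * (geo9Y x).dist y c)) * (wC x c * wH x c) ≤
        ((θ.ℓ₆ + 1 : ℕ) : ℝ) ^ 2 * ((geo9Y x).len y ^ 2)⁻¹ := by
    intro y c
    have hst := scaleTransfer_len_rpow hF (-2) (by norm_num) y c
    have hc := geo9Y_len_pos x c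
    have hy := geo9Y_len_pos x y
    have e1 : ((geo9Y x).len c ^ 2)⁻¹ = (geo9Y x).len c ^ (-2 : ℝ) := by
      rw [show (-2 : ℝ) = -((2 : ℕ) : ℝ) by norm_num, Real.rpow_neg hc.le, Real.rpow_natCast]
    have e2 : ((geo9Y x).len y ^ 2)⁻¹ = (geo9Y x).len y ^ (-2 : ℝ) := by
      rw [show (-2 : ℝ) = -((2 : ℕ) : ℝ) by norm_num, Real.rpow_neg hy.le, Real.rpow_natCast]
    calc Real.exp (-(q.αF * ((1 - 2 * q.α) * q.δ₀) * (geo9Y x).dist y c)) * (wC x c * wH x c)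
        ≤ Real.exp (-(q.αF * ((1 - 2 * q.α) * q.δ₀) * (geo9Y x).dist y c)) * (geo9Y x).len c ^ (-2 : ℝ) := by
          rw [← e1]; exact mul_le_mul_of_nonneg_left (hww x c) (Real.exp_nonneg _)
      _ ≤ ((θ.ℓ₆ + 1 : ℕ) : ℝ) ^ 2 * ((geo9Y x).len y ^ 2)⁻¹ := by
          rw [e2]; exact hst.trans (mul_le_mul_of_nonneg_right hLle (Real.rpow_nonneg hy.le _))
  have hR : ∀ y : (geo9Y x).Site, ∑ c : IBondY x.toKIdx, Real.exp (-(ρR * (geo9Y x).dist y c)) ≤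
      rowConst261 (geo9Y (d := θ.d₆) (ℓ := θ.ℓ₆) (hd := θ.hd') (hL := θ.hL') (b₀ := θ.b₀) (b₁ := θ.b₁) (Mstar := Mstar)) ρR := by
    intro y
    have h := hrowc x ((le_max_right _ _).trans hMx) y
    have huniv : (Finset.univ : Finset (IBondY x.toKIdx)) =
        @Finset.univ (geo9Y x).Site (‹∀ x : MemberY θ.d₆ θ.ℓ₆ θ.hd' θ.hL' θ.b₀ θ.b₁ Mstar, Fintype (geo9Y x).Site› x) := by
      ext c
      exact ⟨fun _ => @Finset.mem_univ (geo9Y x).Site (‹∀ x : MemberY θ.d₆ θ.ℓ₆ θ.hd' θ.hL' θ.b₀ θ.b₁ Mstar, Fintype (geo9Y x).Site› x) c,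
        fun _ => Finset.mem_univ c⟩
    rw [huniv]; exact h
  have hmain := hasMajorant_coordOpK_delta2OfY x.toKIdx (parSymY x.toKIdx) (parBY x.toKIdx) (GpY x.toKIdx (parSymY x.toKIdx)) (𝔠 x).form
    (g := geo9Y x) (R₀ := 1) (H₀ := H x) hgeo (bI x) (fun c => c) U
    (κC := κC) (δC := δC) (tHJ := tHJ * ((geo9Y x).M * α₀)) (ρT := q.αF * ((1 - 2 * q.α) * q.δ₀)) (CT := ((θ.ℓ₆ + 1 : ℕ) : ℝ) ^ 2)
    (ρR := ρR) (cR := rowConst261 (geo9Y (d := θ.d₆) (ℓ := θ.ℓ₆) (hd := θ.hd') (hL := θ.hL') (b₀ := θ.b₀) (b₁ := θ.b₁) (Mstar := Mstar)) ρR)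
    (δ₂ := δ₂) (r := (cR39 (trBasis N))⁻¹) (wC := wC x) (wH := wH x) (W := fun y => ((geo9Y x).len y ^ 2)⁻¹)
    hκC (hwC x) (mul_nonneg htHJ hθ) (hwH x) (by positivity)
    (fun y => inv_nonneg.mpr (pow_nonneg (geo9Y_len_pos x y).le 2)) (inv_nonneg.mpr hc0.le) hδ₂ hτ hρR.le hδC
    (hC2 x hMM α₀ hα ha U hU hU') (hHJ x hMM α₀ hα ha U hU hU') hT hR
  rw [hblk12 x]
  refine hasMajorant_mono _ hmain fun y y' => ?_
  exact kernel_dom hθ₂ hθ (inv_nonneg.mpr (pow_nonneg (geo9Y_len_pos x y).le 2)) (Real.exp_nonneg _)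

/-- ★★ **`hD2L2` FOR ANY WEIGHT SPLIT**: `hD2sup_of_form_schemas_w` + def-Y's reality letters ⟹ edition 29's `hD2L2` at `𝔯 := resYOfC2 N θ M⋆ 𝔠`.
[cite: Balaban1985BackgroundPropagators, (3.137) p.423, (3.134) p.422, (3.46) p.398, p.391; Balaban1985Averaging, (149) p.40; Balaban1984PropagatorsII, (2.51) p.232] -/
theorem hD2L2_of_form_schemas_wR (q : PinPrims) (hq : q.OK) (H : MemberY θ.d₆ θ.ℓ₆ θ.hd' θ.hL' θ.b₀ θ.b₁ Mstar → Prop) (𝔠 : C2Y N θ Mstar)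
    (R₁ R₂ : RegFamY θ.d₆ θ.ℓ₆ θ.hd' θ.hL' θ.b₀ θ.b₁ Mstar (Matrix (Fin N) (Fin N) ℂ)) (hG : MemOfFam (specialUnitaryUnits (Fin N)) R₁) (c : ℝ)
    (𝔬12 : ∀ x : MemberY θ.d₆ θ.ℓ₆ θ.hd' θ.hL' θ.b₀ θ.b₁ Mstar, B9Thm312Whole.Ops (geo9Y x) (bg9Y (Matrix (Fin N) (Fin N) ℂ) (specialUnitaryUnits (Fin N)) x)
      (XBK (TrIdx N) x.toKIdx) (XBK (TrIdx N) x.toKIdx) (XHK (TrIdx N) x.toKIdx) (XSK (TrIdx N) x.toKIdx))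
    (bI : ∀ x : MemberY θ.d₆ θ.ℓ₆ θ.hd' θ.hL' θ.b₀ θ.b₁ Mstar, FBondY x.toKIdx → IBondY x.toKIdx)
    (hblk12 : ∀ x : MemberY θ.d₆ θ.ℓ₆ θ.hd' θ.hL' θ.b₀ θ.b₁ Mstar, (𝔬12 x).blk = blkBK x.toKIdx (bI x))
    (wC wH : ∀ x : MemberY θ.d₆ θ.ℓ₆ θ.hd' θ.hL' θ.b₀ θ.b₁ Mstar, IBondY x.toKIdx → ℝ)
    (hwC : ∀ x c, 0 ≤ wC x c) (hwH : ∀ x c, 0 ≤ wH x c) (hww : ∀ x c, wC x c * wH x c ≤ ((geo9Y x).len c ^ 2)⁻¹)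
    (κC δC tHJ ρR δ₂ θ₂ M a : ℝ) (hκC : 0 ≤ κC) (htHJ : 0 ≤ tHJ) (hρR : 0 < ρR) (hδ₂ : 0 ≤ δ₂) (hθ₂0 : 0 ≤ θ₂) (hM : 0 < M)
    (hδC : δ₂ + q.αF * ((1 - 2 * q.α) * q.δ₀) + ρR ≤ δC)
    (hθ₂ : (cR39 (trBasis N))⁻¹ * (2 * N * basisBound39 (trBasis N) ^ 2 * κC * tHJ * (((θ.ℓ₆ + 1 : ℕ) : ℝ) ^ 2) *
      rowConst261 (geo9Y (d := θ.d₆) (ℓ := θ.ℓ₆) (hd := θ.hd') (hL := θ.hL') (b₀ := θ.b₀) (b₁ := θ.b₁) (Mstar := Mstar)) ρR) ≤ θ₂)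
    (hC2 : ∀ x : MemberY θ.d₆ θ.ℓ₆ θ.hd' θ.hL' θ.b₀ θ.b₁ Mstar, M ≤ (geo9Y x).M → ∀ α₀ : ℝ, 0 < α₀ → (geo9Y x).M * α₀ ≤ a →
      ∀ U : (bg9Y (Matrix (Fin N) (Fin N) ℂ) (specialUnitaryUnits (Fin N)) x).Cfg,
        (bg9YR (Matrix (Fin N) (Fin N) ℂ) (specialUnitaryUnits (Fin N)) R₁ R₂ x).Reg335 c α₀ U →
        (bg9YR (Matrix (Fin N) (Fin N) ℂ) (specialUnitaryUnits (Fin N)) R₁ R₂ x).Reg336 c α₀ U →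
          C2FormMaj x.toKIdx (g := geo9Y x) (bI x) (fun c => c) (𝔠 x).form U κC δC (wC x))
    (hHJ : ∀ x : MemberY θ.d₆ θ.ℓ₆ θ.hd' θ.hL' θ.b₀ θ.b₁ Mstar, M ≤ (geo9Y x).M → ∀ α₀ : ℝ, 0 < α₀ → (geo9Y x).M * α₀ ≤ a →
      ∀ U : (bg9Y (Matrix (Fin N) (Fin N) ℂ) (specialUnitaryUnits (Fin N)) x).Cfg,
        (bg9YR (Matrix (Fin N) (Fin N) ℂ) (specialUnitaryUnits (Fin N)) R₁ R₂ x).Reg335 c α₀ U →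
        (bg9YR (Matrix (Fin N) (Fin N) ℂ) (specialUnitaryUnits (Fin N)) R₁ R₂ x).Reg336 c α₀ U →
          ∀ c : IBondY x.toKIdx,
            ‖trAdjY (trDualMatY N) (HDY x.toKIdx (parSymY x.toKIdx) (parBY x.toKIdx) (GpY x.toKIdx (parSymY x.toKIdx)) U) (JY x.toKIdx U) c‖ ≤
              tHJ * ((geo9Y x).M * α₀) * wH x c)
    (hC : ∀ (x : MemberY θ.d₆ θ.ℓ₆ θ.hd' θ.hL' θ.b₀ θ.b₁ Mstar) (U : CfgY (Matrix (Fin N) (Fin N) ℂ) x.toKIdx), (∀ μ z, U μ z ∈ specialUnitaryUnits (Fin N)) →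
      ∀ A A' : FBondY x.toKIdx → Matrix (Fin N) (Fin N) ℂ, (𝔠 x).form U (star A) (star A') = star ((𝔠 x).form U A A'))
    (hH : ∀ (x : MemberY θ.d₆ θ.ℓ₆ θ.hd' θ.hL' θ.b₀ θ.b₁ Mstar) (U : CfgY (Matrix (Fin N) (Fin N) ℂ) x.toKIdx), (∀ μ z, U μ z ∈ specialUnitaryUnits (Fin N)) →
      ∀ X : IBondY x.toKIdx → Matrix (Fin N) (Fin N) ℂ,
        HDY x.toKIdx (parSymY x.toKIdx) (parBY x.toKIdx) (GpY x.toKIdx (parSymY x.toKIdx)) U (star X) =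
          star (HDY x.toKIdx (parSymY x.toKIdx) (parBY x.toKIdx) (GpY x.toKIdx (parSymY x.toKIdx)) U X)) :
    ∃ ML : ℝ, ∀ x : MemberY θ.d₆ θ.ℓ₆ θ.hd' θ.hL' θ.b₀ θ.b₁ Mstar, ML ≤ (geo9Y x).M → M ≤ (geo9Y x).M → ∀ α₀ : ℝ, 0 < α₀ → (geo9Y x).M * α₀ ≤ a →
      ∀ U : (bg9Y (Matrix (Fin N) (Fin N) ℂ) (specialUnitaryUnits (Fin N)) x).Cfg,
        (bg9YR (Matrix (Fin N) (Fin N) ℂ) (specialUnitaryUnits (Fin N)) R₁ R₂ x).Reg335 c α₀ U →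
        (bg9YR (Matrix (Fin N) (Fin N) ℂ) (specialUnitaryUnits (Fin N)) R₁ R₂ x).Reg336 c α₀ U →
          BlockBd (g := toB6 (geo9Y x) 1 (H x)) (𝔬12 x).blk (𝔬12 x).blk
            (D2coK x.toKIdx (trBasis N) (bg9Y (Matrix (Fin N) (Fin N) ℂ) (specialUnitaryUnits (Fin N)) x) (fun U => U) ((resYOfC2 N θ Mstar 𝔠 x).Δ2) U)
            (fun (y y' : (geo9Y x).Site) => θ₂ * ((geo9Y x).M * α₀) * ((geo9Y x).len y)⁻¹ * ((geo9Y x).len y')⁻¹ *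
              Real.exp (-(δ₂ * (geo9Y x).dist y y'))) := by
  obtain ⟨ML, hsup⟩ := hD2sup_of_form_schemas_wR q hq H 𝔠 R₁ R₂ c 𝔬12 bI hblk12 wC wH hwC hwH hww κC δC tHJ ρR δ₂ θ₂ M a hκC htHJ hρR hδ₂ hM hδC hθ₂ hC2 hHJ
  refine ⟨ML, fun x hMx hMM α₀ hα ha U hU hU' => ?_⟩
  have hgeo : GeoOK (geo9Y x) := ⟨geo9Y_dist_triangle x, geo9Y_dist_comm x, geo9K_dist_nonneg x.toKIdx, geo9Y_len_pos x⟩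
  have hθ : 0 ≤ θ₂ * ((geo9Y x).M * α₀) := mul_nonneg hθ₂0 (mul_nonneg (hM.le.trans hMM) hα.le)
  have hΔ := resYOfC2_Δ2_isSymmTr θ Mstar 𝔠 x (U := U) (fun μ z => specialUnitaryUnits_le_unitaryUnits (hG x c α₀ U hU μ z)) (hC x U (hG x c α₀ U hU)) (hH x U (hG x c α₀ U hU))
  have h := hsup x hMx hMM α₀ hα ha U hU hU'
  rw [hblk12 x] at h ⊢
  exact blockBd_d2coK_of_sup_symm x.toKIdx (bg9Y (Matrix (Fin N) (Fin N) ℂ) (specialUnitaryUnits (Fin N)) x) (fun U => U)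
    ((resYOfC2 N θ Mstar 𝔠 x).Δ2) (R₀ := 1) (H₀ := H x) hgeo hθ h hΔ

end Summit.QuantumFields.YangMills.BalabanUVNodes.N06Delta2AtPinsC2PhysR

end
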